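import Summits.ResolutionOfSingularities.ResolutionOfSingularities.Theses.UniformComplexity
import Summits.ResolutionOfSingularities.ResolutionOfSingularities.Theorems.UniformComplexityCampaignW82AlgClosureFgKernel
import Summits.ResolutionOfSingularities.ResolutionOfSingularities.Theorems.UniformComplexityPrimeModelTransferAlgClosureFgTower
import Summits.ResolutionOfSingularities.ResolutionOfSingularities.Theorems.UniversalCellsCampaignW82FamilyTransferGradedProofs
import HarnessLib

/-!
# Slot W8.2, door 2: LINKS between the finite-trdeg OURS residuals
# `CampaignW82.ClimbRatFuncPerfAlgClosureFg` / `PerfectionStepAlgClosureFgDimLe` and the crux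
# `UniformComplexity.PrimeModelTransfer` (stmt-ResolutionOfSingularities-8933)

Leaf file (imports the route file `Theses.UniformComplexity` directly and otherwise only Theses-free
modules: the lane-signed OURS vocabulary `…CampaignW82AlgClosureFgKernel` (typer res-L1-type-o6,
p475047: the transfer kernel, its grading and the perfection step at the constant fields
`M = (closure s)^{alg} ∩ K`, `K` algebraically closed of characteristic `p`, `s ⊆ K` finite), this
seat's pinned tower `…PrimeModelTransferAlgClosureFgTower` (p474537) and res-L1-s82-pv-1's
finite-level family transfer `…FamilyTransferGradedProofs` (p475166)). The by-name closers
`Theorems.PrimeModelTransfer.primeModelTransfer_of_climbAlgClosureFg` /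
`primeModelTransfer_of_perfectionStepAlgClosureFg` (p475050 / p475882) have these Props UNFOLDED as
hypotheses; here the SIGNED NAMES are linked (re-assembled from the Theses-free tower rather than
imported, so that this leaf does not stack on a Theses-importing module):

* `primeModelTransfer_of_forall_climbRatFuncPerfAlgClosureFg` —
  `(∀ p prime, ClimbRatFuncPerfAlgClosureFg p) → PrimeModelTransfer`;
* `climbRatFuncPerfAlgClosureFg_of_perfectionStepAlgClosureFg_top` —
  `PerfectionStepAlgClosureFgDimLe p ⊤ → ClimbRatFuncPerfAlgClosureFg p` (the finite level
  `SpreadOutRatFuncDimLe p ⊤ ⊤` is pv-1's theorem `spreadOutRatFuncDimLe_top_top`);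
* `primeModelTransfer_of_forall_perfectionStepAlgClosureFgDimLe_top` — THE SHARPEST DOOR-2 RESIDUAL
  ON FILE, BY NAME: `(∀ p prime, PerfectionStepAlgClosureFgDimLe p ⊤) → PrimeModelTransfer` — the crux
  `𝔽_p`-bar ⇒ every algebraically closed field of characteristic `p` hangs only on the perfection step
  «regular model over `M(t)` ⇒ model smooth over some `M(t^{1/p^e})`» at the countably many constant
  fields `M = (𝔽_p(t₁,…,t_n))^{alg}`;
* `climbRatFuncPerfAlgClosureFgDimLe_succ_of_perfectionStepAlgClosureFg` — graded: the kernel grade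
  `(n + 1, n)` at those fields ⇐ the perfection step at grade `n` (`familyTransferSucc_holds`); first
  open grade `n = 4`.

[OURS · LADDER-RESOLUTION L1, slot W8.2 (prime-field / universality transfer), door 2
UniformComplexity] Pure-logic links over the summit's own route; NOT statements of, and attributing
nothing to, Hironaka's 2017 manuscript.
-/

noncomputable section

set_option linter.dupNamespace false -- mandated namespace of this single-conjunct summit

open CategoryTheory CategoryTheory.Limits AlgebraicGeometry
open Literature.AlgebraicGeometry.Resolution

namespace Summit.ResolutionOfSingularities.ResolutionOfSingularities.Theorems.CampaignW82

/-- **Door 2 closes from the kernel at the algebraically closed fields of finite transcendence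
degree**: `(∀ p prime, ClimbRatFuncPerfAlgClosureFg p) → UniformComplexity.PrimeModelTransfer`. For an
algebraically closed `K` of characteristic `p`, every finite `S ⊆ K` lies in the perfect subfield
`(closure S)^{alg} ∩ K`, over which resolution holds by the pinned tower
(`PrimeModelTransfer.hasResolution_algebraicClosure_closure`, kernel consumed at the fields
`(closure s)^{alg} ∩ K` only), and resolution descends to `K`
(`PrimeModelTransfer.hasResolution_of_perfectSubfields`). Same term as
`PrimeModelTransfer.primeModelTransfer_of_climbAlgClosureFg` (p475050). [folklore] -/
theorem primeModelTransfer_of_forall_climbRatFuncPerfAlgClosureFg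
    (h : ∀ p : ℕ, p.Prime → ClimbRatFuncPerfAlgClosureFg p) :
    Summit.ResolutionOfSingularities.ResolutionOfSingularities.Theses.UniformComplexity.PrimeModelTransfer := by
  intro p hp hA K _ _ _ X f hs hl hq hX
  classical
  haveI : Fact p.Prime := ⟨hp⟩
  haveI : PerfectField K := IsAlgClosed.perfectField K
  refine PrimeModelTransfer.hasResolution_of_perfectSubfields K (fun s => ?_) X f hs hl hq hX
  let F : Subfield K := Subfield.closure (↑s : Set K)
  let A : IntermediateField F K := algebraicClosure F K
  haveI : IsAlgClosed A := IsAlgClosure.isAlgClosed F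
  refine ⟨A.toSubfield, fun x hx => ?_, inferInstanceAs (PerfectField A), ?_⟩
  · exact A.algebraMap_mem (⟨x, Subfield.subset_closure hx⟩ : F)
  · exact fun Y g hs' hl' hq' hY =>
      PrimeModelTransfer.hasResolution_algebraicClosure_closure p K (fun k _ _ _ hk => hA k hk)
        (fun s' => h p hp K s') s Y g hs' hl' hq' hY

/-- **The finite-trdeg door-2 kernel from the perfection step at grade `⊤` alone**
(`spreadOutRatFuncDimLe_top_top`, p475166, supplies the finite level over every constant field;
`climbRatFuncPerfAlgClosureFg_iff_top`, p475047). [folklore] -/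
theorem climbRatFuncPerfAlgClosureFg_of_perfectionStepAlgClosureFg_top {p : ℕ}
    (h : PerfectionStepAlgClosureFgDimLe p ⊤) : ClimbRatFuncPerfAlgClosureFg p :=
  (climbRatFuncPerfAlgClosureFg_iff_top p).2
    (climbRatFuncPerfAlgClosureFgDimLe_of_spreadOut_of_perfectionStepAlgClosureFg
      (spreadOutRatFuncDimLe_top_top p) h)

/-- **THE SHARPEST DOOR-2 RESIDUAL, BY NAME.** If, for every prime `p`, the perfection step holds at
grade `⊤` at the constant fields `(closure s)^{alg} ∩ K` (`K` algebraically closed of characteristic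
`p`, `s ⊆ K` finite) — `PerfectionStepAlgClosureFgDimLe p ⊤` — then `UniformComplexity.PrimeModelTransfer`
holds. Same content as `PrimeModelTransfer.primeModelTransfer_of_perfectionStepAlgClosureFg`
(p475882), stated with the lane-signed name. [folklore] -/
theorem primeModelTransfer_of_forall_perfectionStepAlgClosureFgDimLe_top
    (h : ∀ p : ℕ, p.Prime → PerfectionStepAlgClosureFgDimLe p ⊤) :
    Summit.ResolutionOfSingularities.ResolutionOfSingularities.Theses.UniformComplexity.PrimeModelTransfer :=
  primeModelTransfer_of_forall_climbRatFuncPerfAlgClosureFg fun p hp =>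
    climbRatFuncPerfAlgClosureFg_of_perfectionStepAlgClosureFg_top (h p hp)

/-- **Graded: the finite-trdeg kernel grade `(n + 1, n)` IS the finite-trdeg perfection step at
grade `n`** (`familyTransferSucc_holds`, p475166). In particular the first open grade of door 2 is
`PerfectionStepAlgClosureFgDimLe p 4`. [folklore] -/
theorem climbRatFuncPerfAlgClosureFgDimLe_succ_of_perfectionStepAlgClosureFg {p : ℕ} {n : WithBot ℕ∞}
    (h : PerfectionStepAlgClosureFgDimLe p n) : ClimbRatFuncPerfAlgClosureFgDimLe p (n + 1) n :=
  climbRatFuncPerfAlgClosureFgDimLe_of_spreadOut_of_perfectionStepAlgClosureFg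
    (familyTransferSucc_holds p n) h

/-- `PerfectionStepAlgClosureFgDimLe p n → ClimbRatFuncPerfAlgClosureFgDimLe p m n` for every
`m ≥ n + 1` (e.g. `m = ⊤`). [folklore] -/
theorem climbRatFuncPerfAlgClosureFgDimLe_of_perfectionStepAlgClosureFg {p : ℕ} {m n : WithBot ℕ∞}
    (hm : n + 1 ≤ m) (h : PerfectionStepAlgClosureFgDimLe p n) :
    ClimbRatFuncPerfAlgClosureFgDimLe p m n :=
  climbRatFuncPerfAlgClosureFgDimLe_of_spreadOut_of_perfectionStepAlgClosureFg
    (spreadOutRatFuncDimLe_of_add_one_le p hm) h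

end Summit.ResolutionOfSingularities.ResolutionOfSingularities.Theorems.CampaignW82

end
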